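import Literature.Probability.RandomPlanarGeometry.SAWPulledRenewalIdentity
import Literature.Probability.RandomPlanarGeometry.SAWIrreducibleBridgeCrossings
import Literature.Probability.RandomPlanarGeometry.SAWPulledFreeEnergyZ2Tilts
import Literature.Probability.RandomPlanarGeometry.SAWBridgeUpperBound
import Literature.Probability.RandomPlanarGeometry.BDGS2012CountBoundsProofs
import Literature.Probability.Process.RenewalTheorem
import Literature.Probability.Process.RenewalGeometricEnvelope
import Literature.Probability.Process.RenewalRate
import HarnessLib

/-!
# The renewal gap of pulled bridges on `ℤ²`: pulled Kesten relation, finite mean block length,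
# all-`n` Ornstein–Zernike sandwich, the OZ limit and an explicit exponential rate — standard axioms

Topic `Literature/Probability/RandomPlanarGeometry` (continues `SAWPulledRenewalIdentity.lean`: the span-weighted
irreducible-bridge counts `Λ_i(y) = Zd.pulledIrrZ` and their span-`≥ 2` parts `Zd.pulledIrrZ₂`, the block law
`p_i(y) = Λ_i(y) e^{-iλ_B(y)} = Zd.pulledBlockLaw`, the normalised amplitude `a_n(y) = Z^B_n(y) e^{-nλ_B(y)} = Zd.pulledAmp`,
the mean block length `m(y) = Σ i p_i(y) = Zd.pulledMeanBlock`, the normalised renewal equation `Zd.pulledAmp_renewal` and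
the gap-free sub-Kesten inequality `Zd.sum_range_pulledBlockLaw_le_one`; the three-crossings lemma
`Zd.three_mul_span_le` of `SAWIrreducibleBridgeCrossings.lean`; the free energy `λ_B` of `SAWPulledBridgeFreeEnergy.lean`
with the span-1 tilted-Kraft windows of `SAWPulledFreeEnergyZ2Tilts.lean`; `b_n ≤ μ^n` (`SAWBridgeUpperBound.lean`) and
`μ(ℤ²) ≤ 3` (`BDGS2012CountBoundsProofs.lean`); and the model-free renewal files `Process/RenewalGeometricEnvelope.lean`
(persistence from a geometric envelope), `Process/RenewalRate.lean` (explicit rate), `Process/RenewalTheorem.lean`).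

Sources. N. Madras, G. Slade, *The Self-Avoiding Walk* (1993; 2013 reprint pagination), §4.2: the renewal structure of
bridges by irreducible bridges, (4.2.15)–(4.2.16) (Kesten's relation and the renewal limit in the mass parametrisation,
p. 93), the remark after Theorem 4.2.4 with (4.2.21)–(4.2.22) (p. 94: "an irreducible bridge of span `L ≥ 2` must have
at least `3L` steps", whence a mass gap for `z` small), Theorem 4.2.2 (b) (renewal theorem), Theorem 4.2.5 (p. 95:
`|B_z(L)e^{m(z)L} - C_z| ≤ e^{-ε(z)L}` for SOME `ε(z) > 0`, by residues), Appendix B (B.5); N. R. Beaton, J. Phys. A 48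
(2015) 16FT03, Lemma 2 (`I(e^{-λ(y)}, y) = 1` for every `y ≥ 1`, via Madras–Slade (4.2.15)); D. Ioffe, Y. Velenik (2008),
(3.9)–(3.10), (3.31)–(3.33) (Ornstein–Zernike behaviour in the ballistic phase, constants inexplicit).

## What is proved here (lane «pcv-sawmu», route R35 «PULL-GAP», items R35.3♯ / R35.4 / R35.5 / R35.7 / R35.8-for-bridges)

Everything is read along the LENGTH axis at a fixed tilt `y`, through a LADDER RUNG `1 ≤ y' ≤ y` carrying a certified
upper window `λ_B(y') ≤ log U'`, against a certified lower window `log L ≤ λ_B(y)` (`t := y'/y`):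

* `pulledAmp_mul_pow_unbounded` — exponential sharpness of the Fekete normalisation: `a_n(y) s^n` is unbounded for every
  `s > 1` (every `ℤ^{d+1}`); `pulledBridgeFreeEnergy_nonneg`, `pulledBridgeFreeEnergy_one_le_log` (`λ_B(1) ≤ log U` for
  any `U ≥ μ`, since `Z^B_N(1) = b_N ≤ μ^N`);
* **`pulledIrrZ₂_mul_exp_le_ladder` (R35.3♯, Hölder in the span)**: `p_i^{(≥2)}(y) ≤ t^{-2/3}·(t^{-1/3}U'/L)^i·p_i(y')`
  (the three-crossings bound `A ≤ (i+2)/3` and `y^A = t^{-A} y'^A`); with `p_i(y') ≤ 1` and the two L-shaped span-1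
  walks this gives the geometric envelope `pulledBlockLaw_le_geometric_ladder`: `p_i(y) ≤ (2y + t^{-2/3})·q₂^i`,
  `q₂ = t^{-1/3} U'/L`, for EVERY `i`;
* **`hasSum_pulledBlockLaw_ladder` (R35.4)** — under the LADDER GAP CONDITION `y·U'³ < y'·L³` (i.e. `q₂ < 1`):
  `Σ_i p_i(y) = 1` (the pulled Kesten relation), by the elementary persistence criterion
  `Renewal.hasSum_f_one_of_envelope` — no generating-function analysis; **`summable_mul_pulledBlockLaw_ladder` (R35.5)**
  — `m(y) < ∞`; at the rung `y' = 1` the condition reads `y·U³ < L³` for any `U ≥ μ` (`pulledGap_of_mu_le`);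
* the compositions, in every dimension given the relation and a finite mean (`_of` forms), and packaged on `ℤ²`
  (`pulledGap_ladder`): for EVERY `n`, `2 - m(y) ≤ a_n(y) ≤ 1`, i.e. `(2 - m(y))·e^{nλ_B(y)} ≤ Z^B_n(y) ≤ e^{nλ_B(y)}`
  (R35.7, Madras–Slade (B.5)); `a_n(y) → 1/m(y)` (renewal theorem); and the explicit rate
  `|a_n(y) - 1/m(y)| ≤ H/(m(y)(1-G))·r^{-n}` for any `r ≥ 1` and values `G < 1`, `H` of the two tail series of the block
  law (R35.8, `Renewal.abs_sub_inv_tsum_le`);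
* **DATA-FREE STANDARD-AXIOM INSTANCES** with `y' = 1`, `U = 3 ≥ μ(ℤ²)` and the span-1 windows: `pulledGap_four`
  (`L = 10⁴/1754`: `4·27 = 108 < L³ = 185.3`), `pulledGap_three` (`10⁴/2153`: `81 < 100.2`), `pulledGap_r256_81`
  (`10⁴/2077`: `85.3 < 111.6`) — at each: relation ∧ finite mean ∧ all-`n` sandwich ∧ OZ limit.

The COMPUTATIONAL editions (sharper `U = 2.688` from the `K = 18` finite-memory certificate, the planner's literal
`2.688³·y < L³` form via `SAWPulledSpanEnvelope.lean`, and the tilts `y ∈ {3/2, 25/16, 125/64, 2}`) are in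
`SAWPulledRenewalGapTilts.lean`. Printed status: R35.4 is PRINTED qualitatively for all `y ≥ 1` (Beaton Lemma 2 via
(4.2.15)); the gap mechanism is PRINTED as (4.2.21)–(4.2.22) ("`z` sufficiently small"); the explicit certified regime, the
rung device, the all-`n` constant `2 - m(y)` and the explicit rate are NEW (print: `∃ ε(z)`, `C_z` unevaluated). Numerical
windows for `m(y)` (lane rows M-R35-3/3♯) are census items, NOT statements of this file. Guard rows P-R35-1/2/3/3♯ of the
lane were signed TRUE before filing (refute-first).
-/

noncomputable section

open Finset Filter Topology
open scoped BigOperators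
open Literature.Probability.LatticeModels
open Literature.Probability.RandomPlanarGeometry.SAW

namespace Literature.Probability.RandomPlanarGeometry.SAW.Zd

/-! ### Exponential sharpness of the Fekete normalisation -/

/-- **`a_n(y) s^n` is unbounded for every `s > 1`** (`a_n = Z^B_n e^{-nλ_B}`): since `n⁻¹ log Z^B_n(y) → λ_B(y)`
(`Zd.tendsto_pulledBridgeFreeEnergy`), eventually `a_n(y) s^n ≥ e^{n (log s)/2} → ∞`.
[cite: MadrasSlade1993, Lemma 1.2.2 (Fekete); Beaton2015, §3] -/
theorem pulledAmp_mul_pow_unbounded (d : ℕ) {y : ℝ} (hy : 0 < y) {s : ℝ} (hs : 1 < s) (M : ℝ) :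
    ∃ n : ℕ, M < pulledAmp (d + 1) y n * s ^ n := by
  set lam := pulledBridgeFreeEnergy (d + 1) y with hlam
  set ε : ℝ := Real.log s / 2 with hε
  have hlogs : 0 < Real.log s := Real.log_pos hs
  have hε0 : 0 < ε := by rw [hε]; linarith
  have hs0 : 0 < s := by linarith
  have hev : ∀ᶠ n : ℕ in atTop, lam - ε < Real.log (pulledBridgeZ (d + 1) n y) / n :=
    (tendsto_pulledBridgeFreeEnergy d hy).eventually (Ioi_mem_nhds (by linarith : lam - ε < lam))
  have hexp : Tendsto (fun n : ℕ => Real.exp (n * ε)) atTop atTop :=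
    Real.tendsto_exp_atTop.comp (tendsto_natCast_atTop_atTop.atTop_mul_const hε0)
  have hbig : ∀ᶠ n : ℕ in atTop, M < Real.exp (n * ε) := hexp.eventually (eventually_gt_atTop M)
  obtain ⟨n, hn1, hn2, hn3⟩ := (hev.and (hbig.and (eventually_ge_atTop 1))).exists
  refine ⟨n, lt_of_lt_of_le hn2 ?_⟩
  have hn0 : (0 : ℝ) < n := by exact_mod_cast hn3
  have h1 : Real.exp ((n : ℝ) * (lam - ε)) ≤ pulledBridgeZ (d + 1) n y := by
    refine (Real.le_log_iff_exp_le (pulledBridgeZ_pos d n hy)).1 ?_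
    rw [lt_div_iff₀ hn0] at hn1; linarith
  have hsn : s ^ n = Real.exp ((n : ℝ) * Real.log s) := by rw [Real.exp_nat_mul, Real.exp_log hs0]
  unfold pulledAmp
  calc Real.exp ((n : ℝ) * ε)
      = Real.exp ((n : ℝ) * (lam - ε)) * Real.exp (-(n : ℝ) * lam) * Real.exp ((n : ℝ) * Real.log s) := by
        rw [← Real.exp_add, ← Real.exp_add]; congr 1; rw [hε]; ring
    _ ≤ pulledBridgeZ (d + 1) n y * Real.exp (-(n : ℝ) * lam) * s ^ n := by
        rw [hsn]
        exact mul_le_mul_of_nonneg_right (mul_le_mul_of_nonneg_right h1 (Real.exp_pos _).le)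
          (Real.exp_pos _).le

/-! ### Windows at the rung -/

/-- `λ_B(y) ≥ 0` for `y ≥ 1` (every `ℤ^{d+1}`): `Z^B_1(y) ≥ Λ_1(y) = y ≥ 1` and `λ_B = sup_N N⁻¹ log Z^B_N`.
[cite: Beaton2015, §3] -/
theorem pulledBridgeFreeEnergy_nonneg (d : ℕ) {y : ℝ} (hy : 1 ≤ y) : 0 ≤ pulledBridgeFreeEnergy (d + 1) y := by
  have hy0 : 0 < y := by linarith
  have h := log_div_le_pulledBridgeFreeEnergy d hy0 (N := 1) le_rfl
  have hZ : y ≤ pulledBridgeZ (d + 1) 1 y := by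
    have := pulledIrrZ_le_pulledBridgeZ (d := d + 1) 1 hy0.le
    rwa [pulledIrrZ_one] at this
  have hlog : 0 ≤ Real.log (pulledBridgeZ (d + 1) 1 y) := Real.log_nonneg (hy.trans hZ)
  simp only [Nat.cast_one, div_one] at h
  linarith

/-- `λ_B(1) ≤ log U` for any `U ≥ μ` (every `ℤ^{d+1}`): `Z^B_N(1) = b_N ≤ μ^N ≤ U^N`.
[cite: MadrasSlade1993, §1.2, eq. (1.2.17); Beaton2015, §3] -/
theorem pulledBridgeFreeEnergy_one_le_log (d : ℕ) {U : ℝ} (hU : connectiveConstant (d + 1) ≤ U) :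
    pulledBridgeFreeEnergy (d + 1) 1 ≤ Real.log U := by
  have hμ := connectiveConstant_pos (d + 1)
  have hU0 : 0 < U := lt_of_lt_of_le hμ hU
  refine pulledBridgeFreeEnergy_le_log_of_geometric d (y := 1) (C := 1) one_pos one_pos hU0 fun N => ?_
  rw [one_mul, pulledBridgeZ_eq_sum_bridges]
  calc ∑ ω ∈ bridges (d + 1) N, (1 : ℝ) ^ (ω N 0).toNat = (bridgeCount (d + 1) N : ℝ) := by simp [bridgeCount]
    _ ≤ connectiveConstant (d + 1) ^ N := bridgeCount_le_pow N
    _ ≤ U ^ N := pow_le_pow_left₀ hμ.le hU N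

/-! ### The geometric envelope of the block law from a ladder rung (R35.3♯) -/

/-- `e^{-iλ} ≤ (L^i)⁻¹` when `log L ≤ λ` and `L > 0`. [folklore] -/
private theorem exp_neg_mul_le_inv_pow_of_log_le {L lam : ℝ} (hL : 0 < L) (hLB : Real.log L ≤ lam) (i : ℕ) :
    Real.exp (-(i : ℝ) * lam) ≤ (L ^ i)⁻¹ := by
  have h1 : L ^ i ≤ Real.exp ((i : ℝ) * lam) := by
    calc L ^ i = Real.exp (Real.log L) ^ i := by rw [Real.exp_log hL]
      _ = Real.exp ((i : ℝ) * Real.log L) := by rw [← Real.exp_nat_mul]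
      _ ≤ Real.exp ((i : ℝ) * lam) := Real.exp_le_exp.2 (mul_le_mul_of_nonneg_left hLB (Nat.cast_nonneg _))
  rw [show -(i : ℝ) * lam = -((i : ℝ) * lam) by ring, Real.exp_neg]
  exact inv_anti₀ (pow_pos hL i) h1

/-- The span-1 part of `Λ_i(y)` is at most `2y` for every `i ≥ 1`: `Λ_i(y) ≤ Λ_i^{(≥2)}(y) + 2y` (equality for
`i ≥ 2` by `pulledIrrZ_sub_pulledIrrZ₂`; `Λ_1(y) = y`). [cite: MadrasSlade1993, §4.2 (irreducible bridges)] -/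
theorem pulledIrrZ_le_pulledIrrZ₂_add (i : ℕ) (hi : 1 ≤ i) {y : ℝ} (hy : 0 ≤ y) :
    pulledIrrZ 2 i y ≤ pulledIrrZ₂ 2 i y + 2 * y := by
  rcases Nat.lt_or_ge i 2 with h | h
  · have hi1 : i = 1 := by omega
    subst hi1
    rw [pulledIrrZ_one 2 y]
    have h0 : 0 ≤ pulledIrrZ₂ 2 1 y := pulledIrrZ₂_nonneg 1 hy
    linarith
  · have := pulledIrrZ_sub_pulledIrrZ₂ i h y
    linarith

/-- Hölder in the span: for `T ≥ 1` and `3A ≤ i + 2`, `T^A ≤ T^{2/3} · (T^{1/3})^i`.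
[cite: MadrasSlade1993, §4.2, (4.2.21)] -/
theorem pow_le_rpow_two_thirds_mul_pow {T : ℝ} (hT : 1 ≤ T) {A i : ℕ} (h : 3 * A ≤ i + 2) :
    T ^ A ≤ T ^ (2 / 3 : ℝ) * (T ^ (1 / 3 : ℝ)) ^ i := by
  have hT0 : 0 ≤ T := by linarith
  have hT3 : 1 ≤ T ^ (1 / 3 : ℝ) := Real.one_le_rpow hT (by norm_num)
  have e1 : T ^ A = (T ^ (1 / 3 : ℝ)) ^ (3 * A) := by
    rw [pow_mul, ← Real.rpow_natCast (T ^ (1 / 3 : ℝ)) 3, ← Real.rpow_mul hT0]; norm_num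
  have e2 : T ^ (2 / 3 : ℝ) * (T ^ (1 / 3 : ℝ)) ^ i = (T ^ (1 / 3 : ℝ)) ^ (i + 2) := by
    rw [pow_add, mul_comm, ← Real.rpow_natCast (T ^ (1 / 3 : ℝ)) 2, ← Real.rpow_mul hT0]; norm_num
  rw [e1, e2]
  exact pow_le_pow_right₀ hT3 h

/-- **R35.3♯ — tilt-ladder envelope of the span-`≥ 2` part.** For `1 ≤ y' ≤ y`, `L, U' > 0` with certified
`log L ≤ λ_B(y)` and `λ_B(y') ≤ log U'`: `p_i^{(≥2)}(y) ≤ (y/y')^{2/3} · ((y/y')^{1/3} U'/L)^i · p_i(y')`.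
(At `y' = 1`, `U' = 2.688` this is the plain envelope times `p_i(1) ≤ 1`.)
[cite: MadrasSlade1993, (4.2.21)–(4.2.22); Beaton2015, Lemma 2] -/
theorem pulledIrrZ₂_mul_exp_le_ladder (i : ℕ) {y y' L U' : ℝ} (hy' : 1 ≤ y') (hyy : y' ≤ y) (hL : 0 < L)
    (hU : 0 < U') (hLB : Real.log L ≤ pulledBridgeFreeEnergy 2 y)
    (hUB : pulledBridgeFreeEnergy 2 y' ≤ Real.log U') :
    pulledIrrZ₂ 2 i y * Real.exp (-(i : ℝ) * pulledBridgeFreeEnergy 2 y)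
      ≤ (y / y') ^ (2 / 3 : ℝ) * ((y / y') ^ (1 / 3 : ℝ) * U' / L) ^ i * pulledBlockLaw 2 y' i := by
  classical
  have hy'0 : 0 < y' := by linarith
  set T : ℝ := y / y' with hT
  have hT1 : 1 ≤ T := by rw [hT, le_div_iff₀ hy'0]; linarith
  have hT0 : 0 ≤ T := by linarith
  set F : ℝ := T ^ (2 / 3 : ℝ) * (T ^ (1 / 3 : ℝ)) ^ i with hF
  have hF0 : 0 ≤ F := by positivity
  -- termwise Hölder on the span `≥ 2` filter
  have hterm : ∀ ω ∈ (irreducibleBridges 2 i).filter (fun ω => (2 : ℤ) ≤ ω i 0),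
      y ^ (ω i 0).toNat ≤ F * y' ^ (ω i 0).toNat := by
    intro ω hω
    rw [Finset.mem_filter] at hω
    have h3 := three_mul_span_le hω.1
    have hyT : y = T * y' := by rw [hT]; field_simp
    rw [hyT, mul_pow]
    exact mul_le_mul_of_nonneg_right (pow_le_rpow_two_thirds_mul_pow hT1 h3) (pow_nonneg hy'0.le _)
  have hsum : pulledIrrZ₂ 2 i y ≤ F * pulledIrrZ 2 i y' := by
    calc pulledIrrZ₂ 2 i y
        ≤ ∑ ω ∈ (irreducibleBridges 2 i).filter (fun ω => (2 : ℤ) ≤ ω i 0), F * y' ^ (ω i 0).toNat :=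
          Finset.sum_le_sum hterm
      _ = F * pulledIrrZ₂ 2 i y' := by rw [pulledIrrZ₂, Finset.mul_sum]
      _ ≤ F * pulledIrrZ 2 i y' := mul_le_mul_of_nonneg_left (pulledIrrZ₂_le_pulledIrrZ i hy'0.le) hF0
  -- `Λ_i(y') ≤ p_i(y') U'^i`
  have hp0 : 0 ≤ pulledBlockLaw 2 y' i := pulledBlockLaw_nonneg hy'0.le i
  have hIrr : pulledIrrZ 2 i y' ≤ pulledBlockLaw 2 y' i * U' ^ i := by
    have hE : Real.exp ((i : ℝ) * pulledBridgeFreeEnergy 2 y') ≤ U' ^ i := by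
      calc Real.exp ((i : ℝ) * pulledBridgeFreeEnergy 2 y') ≤ Real.exp ((i : ℝ) * Real.log U') :=
            Real.exp_le_exp.2 (mul_le_mul_of_nonneg_left hUB (Nat.cast_nonneg _))
        _ = U' ^ i := by rw [Real.exp_nat_mul, Real.exp_log hU]
    have hkey : pulledIrrZ 2 i y' = pulledBlockLaw 2 y' i * Real.exp ((i : ℝ) * pulledBridgeFreeEnergy 2 y') := by
      unfold pulledBlockLaw; rw [mul_assoc, ← Real.exp_add]; simp
    rw [hkey]
    exact mul_le_mul_of_nonneg_left hE hp0
  have hexp := exp_neg_mul_le_inv_pow_of_log_le hL hLB i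
  have hE0 : 0 ≤ Real.exp (-(i : ℝ) * pulledBridgeFreeEnergy 2 y) := (Real.exp_pos _).le
  have hFp : 0 ≤ F * (pulledBlockLaw 2 y' i * U' ^ i) := mul_nonneg hF0 (mul_nonneg hp0 (pow_nonneg hU.le _))
  have hLi : (0 : ℝ) < L ^ i := pow_pos hL i
  calc pulledIrrZ₂ 2 i y * Real.exp (-(i : ℝ) * pulledBridgeFreeEnergy 2 y)
      ≤ (F * (pulledBlockLaw 2 y' i * U' ^ i)) * (L ^ i)⁻¹ :=
        mul_le_mul (hsum.trans (mul_le_mul_of_nonneg_left hIrr hF0)) hexp hE0 hFp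
    _ = T ^ (2 / 3 : ℝ) * (T ^ (1 / 3 : ℝ) * U' / L) ^ i * pulledBlockLaw 2 y' i := by
        rw [hF, div_pow, mul_pow]
        field_simp

/-- The ladder gap ratio `q₂ = (y/y')^{1/3} U'/L` is `< 1` exactly when `y·U'³ < y'·L³` (cube-root-free form).
[cite: MadrasSlade1993, §4.2, (4.2.22)] -/
theorem ladderRatio_lt_one {y y' L U' : ℝ} (hy'0 : 0 < y') (hyy : y' ≤ y) (hL : 0 < L) (hU : 0 < U')
    (hq2 : y * U' ^ 3 < y' * L ^ 3) : (y / y') ^ (1 / 3 : ℝ) * U' / L < 1 := by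
  have hT0 : 0 ≤ y / y' := div_nonneg (by linarith) hy'0.le
  rw [div_lt_one hL]
  by_contra h
  rw [not_lt] at h
  have hcube : ((y / y') ^ (1 / 3 : ℝ)) ^ 3 = y / y' := by
    rw [← Real.rpow_natCast ((y / y') ^ (1 / 3 : ℝ)) 3, ← Real.rpow_mul hT0]; norm_num
  have h4 : L ^ 3 ≤ ((y / y') ^ (1 / 3 : ℝ) * U') ^ 3 := pow_le_pow_left₀ hL.le h 3
  rw [mul_pow, hcube] at h4
  have h5 : y' * L ^ 3 ≤ y' * (y / y' * U' ^ 3) := mul_le_mul_of_nonneg_left h4 hy'0.le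
  have h6 : y' * (y / y' * U' ^ 3) = y * U' ^ 3 := by field_simp
  linarith

/-- `L⁻¹ ≤ q₂` (the span-1 decay rate is dominated by the ladder ratio): uses `U' ≥ 1`, which follows from
`λ_B(y') ≥ 0`. [cite: MadrasSlade1993, §4.2, (4.2.22)] -/
theorem inv_le_ladderRatio {y y' L U' : ℝ} (hy' : 1 ≤ y') (hyy : y' ≤ y) (hL : 0 < L) (hU : 0 < U')
    (hUB : pulledBridgeFreeEnergy 2 y' ≤ Real.log U') : L⁻¹ ≤ (y / y') ^ (1 / 3 : ℝ) * U' / L := by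
  have hy'0 : 0 < y' := by linarith
  have hU1 : 1 ≤ U' := by
    have h0 : 0 ≤ Real.log U' := (pulledBridgeFreeEnergy_nonneg 1 hy').trans hUB
    rwa [Real.log_nonneg_iff hU] at h0
  have hT1 : 1 ≤ y / y' := by rw [le_div_iff₀ hy'0]; linarith
  have hT3 : 1 ≤ (y / y') ^ (1 / 3 : ℝ) := Real.one_le_rpow hT1 (by norm_num)
  rw [inv_eq_one_div]
  refine div_le_div_of_nonneg_right ?_ hL.le
  nlinarith

/-- `p_i(y) ≤ 1` for every `i` (`y > 0`): a single term of the gap-free sub-Kesten inequality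
`Σ_{i<K} p_i(y) ≤ 1`. [cite: Beaton2015, §3, Lemma 2] -/
theorem pulledBlockLaw_le_one (d : ℕ) {y : ℝ} (hy : 0 < y) (i : ℕ) : pulledBlockLaw (d + 1) y i ≤ 1 := by
  have h := sum_range_pulledBlockLaw_le_one d hy (i + 1)
  have hmem : i ∈ range (i + 1) := by simp
  exact (Finset.single_le_sum (f := pulledBlockLaw (d + 1) y) (fun k _ => pulledBlockLaw_nonneg hy.le k) hmem).trans h

/-- **Geometric envelope of the block law from a ladder rung**: for `1 ≤ y' ≤ y` with certified
`log L ≤ λ_B(y)`, `λ_B(y') ≤ log U'`: `p_i(y) ≤ (2y + (y/y')^{2/3}) · q₂^i` for EVERY `i`, `q₂ = (y/y')^{1/3} U'/L`.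
[cite: MadrasSlade1993, (4.2.21)–(4.2.22); Beaton2015, Lemma 2] -/
theorem pulledBlockLaw_le_geometric_ladder {y y' L U' : ℝ} (hy' : 1 ≤ y') (hyy : y' ≤ y) (hL : 0 < L)
    (hU : 0 < U') (hLB : Real.log L ≤ pulledBridgeFreeEnergy 2 y)
    (hUB : pulledBridgeFreeEnergy 2 y' ≤ Real.log U') (i : ℕ) :
    pulledBlockLaw 2 y i ≤ (2 * y + (y / y') ^ (2 / 3 : ℝ)) * ((y / y') ^ (1 / 3 : ℝ) * U' / L) ^ i := by
  have hy'0 : 0 < y' := by linarith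
  have hy0 : 0 < y := by linarith
  have hT0 : 0 ≤ y / y' := div_nonneg hy0.le hy'0.le
  set q : ℝ := (y / y') ^ (1 / 3 : ℝ) * U' / L with hqdef
  have hq0 : 0 ≤ q := by rw [hqdef]; positivity
  rcases Nat.eq_zero_or_pos i with rfl | hi
  · rw [pulledBlockLaw_zero y, pow_zero, mul_one]
    positivity
  · set E := Real.exp (-(i : ℝ) * pulledBridgeFreeEnergy 2 y) with hE
    have hE0 : 0 ≤ E := (Real.exp_pos _).le
    have h2 := pulledIrrZ₂_mul_exp_le_ladder i hy' hyy hL hU hLB hUB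
    have hp1 : pulledBlockLaw 2 y' i ≤ 1 := pulledBlockLaw_le_one 1 hy'0 i
    have hEL : E ≤ (L ^ i)⁻¹ := exp_neg_mul_le_inv_pow_of_log_le hL hLB i
    have hLq : (L ^ i)⁻¹ ≤ q ^ i := by
      rw [← inv_pow]
      exact pow_le_pow_left₀ (inv_nonneg.2 hL.le) (inv_le_ladderRatio hy' hyy hL hU hUB) i
    have hsplit := pulledIrrZ_le_pulledIrrZ₂_add i hi hy0.le
    have hF0 : 0 ≤ (y / y') ^ (2 / 3 : ℝ) * q ^ i := by positivity
    unfold pulledBlockLaw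
    calc pulledIrrZ 2 i y * E ≤ (pulledIrrZ₂ 2 i y + 2 * y) * E := mul_le_mul_of_nonneg_right hsplit hE0
      _ = pulledIrrZ₂ 2 i y * E + 2 * y * E := by ring
      _ ≤ (y / y') ^ (2 / 3 : ℝ) * q ^ i * pulledBlockLaw 2 y' i + 2 * y * q ^ i :=
          add_le_add h2 (mul_le_mul_of_nonneg_left (hEL.trans hLq) (by linarith))
      _ ≤ (y / y') ^ (2 / 3 : ℝ) * q ^ i * 1 + 2 * y * q ^ i :=
          add_le_add (mul_le_mul_of_nonneg_left hp1 hF0) le_rfl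
      _ = (2 * y + (y / y') ^ (2 / 3 : ℝ)) * q ^ i := by ring

/-- **R35.4♯ — pulled Kesten relation under the LADDER gap condition** `y·U'³ < y'·L³`.
[cite: Beaton2015, Lemma 2; MadrasSlade1993, (4.2.15)] -/
theorem hasSum_pulledBlockLaw_ladder {y y' L U' : ℝ} (hy' : 1 ≤ y') (hyy : y' ≤ y) (hL : 0 < L) (hU : 0 < U')
    (hLB : Real.log L ≤ pulledBridgeFreeEnergy 2 y) (hUB : pulledBridgeFreeEnergy 2 y' ≤ Real.log U')
    (hq2 : y * U' ^ 3 < y' * L ^ 3) :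
    HasSum (pulledBlockLaw 2 y) 1 := by
  have hy'0 : 0 < y' := by linarith
  have hy0 : 0 < y := by linarith
  have hq1 := ladderRatio_lt_one hy'0 hyy hL hU hq2
  have hq0 : 0 < (y / y') ^ (1 / 3 : ℝ) * U' / L :=
    lt_of_lt_of_le (inv_pos.2 hL) (inv_le_ladderRatio hy' hyy hL hU hUB)
  exact Literature.Probability.Process.Renewal.hasSum_f_one_of_envelope (pulledAmp_zero 1 y)
    (pulledAmp_nonneg 1 hy0) (pulledAmp_le_one 1 hy0) (pulledBlockLaw_nonneg hy0.le) (pulledBlockLaw_zero y)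
    (fun n hn => pulledAmp_renewal 1 y n hn) hq0 hq1 (pulledBlockLaw_le_geometric_ladder hy' hyy hL hU hLB hUB)
    (fun s hs M => pulledAmp_mul_pow_unbounded 1 hy0 hs M)

/-- **R35.5♯ — finite mean block length under the ladder gap condition.**
[cite: MadrasSlade1993, Theorem 4.2.2 (b); Beaton2015, Lemma 2] -/
theorem summable_mul_pulledBlockLaw_ladder {y y' L U' : ℝ} (hy' : 1 ≤ y') (hyy : y' ≤ y) (hL : 0 < L)
    (hU : 0 < U') (hLB : Real.log L ≤ pulledBridgeFreeEnergy 2 y)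
    (hUB : pulledBridgeFreeEnergy 2 y' ≤ Real.log U') (hq2 : y * U' ^ 3 < y' * L ^ 3) :
    Summable fun i : ℕ => (i : ℝ) * pulledBlockLaw 2 y i := by
  have hy'0 : 0 < y' := by linarith
  have hy0 : 0 < y := by linarith
  have hq1 := ladderRatio_lt_one hy'0 hyy hL hU hq2
  have hq0 : 0 < (y / y') ^ (1 / 3 : ℝ) * U' / L :=
    lt_of_lt_of_le (inv_pos.2 hL) (inv_le_ladderRatio hy' hyy hL hU hUB)
  exact Literature.Probability.Process.Renewal.summable_mul_f_of_envelope (pulledBlockLaw_nonneg hy0.le) hq0 hq1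
    (pulledBlockLaw_le_geometric_ladder hy' hyy hL hU hLB hUB)

/-! ### R35.7 / R35.8: all-`n` Ornstein–Zernike sandwich, the limit, and an explicit exponential rate -/

/-- Model-free all-`n` lower bound (Madras–Slade (B.5) + `u ≤ 1`): for a renewal sequence with `Σ f = 1` and
finite mean `m = Σ k f_k`, `u_n ≥ 2 - m` for EVERY `n`. [cite: MadrasSlade1993, Appendix B, (B.5)] -/
theorem renewal_two_sub_tsum_le {u f : ℕ → ℝ} (hu0 : u 0 = 1) (hu1 : ∀ n, u n ≤ 1)
    (hf : ∀ k, 0 ≤ f k) (hf0 : f 0 = 0)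
    (hren : ∀ n, 1 ≤ n → u n = ∑ k ∈ range (n + 1), f k * u (n - k)) (hf1 : HasSum f 1)
    (hmean : Summable fun k : ℕ => (k : ℝ) * f k) (n : ℕ) :
    2 - ∑' k : ℕ, (k : ℝ) * f k ≤ u n := by
  set r : ℕ → ℝ := fun n => 1 - ∑ k ∈ range (n + 1), f k with hr'
  have hr : ∀ n, r n = 1 - ∑ k ∈ range (n + 1), f k := fun n => rfl
  have hB5 := Literature.Probability.Process.Renewal.sum_tailSum_mul_eq_one hr hu0 hf0 hren n
  have hsum := Literature.Probability.Process.Renewal.sum_range_succ_tailSum_le_tsum hr hf hf1 hmean n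
  have hr0 : r 0 = 1 := by simp [hr, hf0]
  have hrnn : ∀ k, 0 ≤ r k := fun k =>
    Literature.Probability.Process.Renewal.tailSum_nonneg hr hf hf1 k
  rw [Finset.sum_range_succ'] at hB5
  simp only [Nat.sub_zero, hr0, one_mul] at hB5
  have hle : ∑ k ∈ range n, r (k + 1) * u (n - (k + 1)) ≤ ∑ k ∈ range n, r (k + 1) := by
    refine Finset.sum_le_sum fun k _ => ?_
    calc r (k + 1) * u (n - (k + 1)) ≤ r (k + 1) * 1 :=
          mul_le_mul_of_nonneg_left (hu1 _) (hrnn _)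
      _ = r (k + 1) := mul_one _
  have hshift : ∑ k ∈ range n, r (k + 1) = ∑ k ∈ range (n + 1), r k - 1 := by
    rw [Finset.sum_range_succ', hr0]; ring
  linarith

/-- **All-`n` two-sided amplitude bound, every dimension, given the relation and a finite mean**:
`2 - m(y) ≤ a_n(y) ≤ 1` for EVERY `n`. [cite: MadrasSlade1993, Appendix B, (B.5); IoffeVelenik2008, (3.31)–(3.33)] -/
theorem two_sub_pulledMeanBlock_le_pulledAmp_of (d : ℕ) {y : ℝ} (hy : 0 < y)
    (hK : HasSum (pulledBlockLaw (d + 1) y) 1) (hM : Summable fun i : ℕ => (i : ℝ) * pulledBlockLaw (d + 1) y i)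
    (n : ℕ) : 2 - pulledMeanBlock (d + 1) y ≤ pulledAmp (d + 1) y n ∧ pulledAmp (d + 1) y n ≤ 1 :=
  ⟨renewal_two_sub_tsum_le (pulledAmp_zero d y) (pulledAmp_le_one d hy)
    (pulledBlockLaw_nonneg hy.le) (pulledBlockLaw_zero y) (fun n hn => pulledAmp_renewal d y n hn) hK hM n,
   pulledAmp_le_one d hy n⟩

/-- **Ornstein–Zernike limit, every dimension, given the relation and a finite mean**: `a_n(y) → 1/m(y)`
(renewal theorem; aperiodic since `p_1(y) = y e^{-λ_B(y)} > 0`).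
[cite: MadrasSlade1993, Theorem 4.2.2 (b) and (4.2.16)] -/
theorem tendsto_pulledAmp_of (d : ℕ) {y : ℝ} (hy : 0 < y)
    (hK : HasSum (pulledBlockLaw (d + 1) y) 1) (hM : Summable fun i : ℕ => (i : ℝ) * pulledBlockLaw (d + 1) y i) :
    Tendsto (pulledAmp (d + 1) y) atTop (𝓝 (pulledMeanBlock (d + 1) y)⁻¹) :=
  Literature.Probability.Process.Renewal.tendsto_of_summable_mul (pulledAmp_zero d y)
    (pulledAmp_nonneg d hy) (pulledAmp_le_one d hy) (pulledBlockLaw_nonneg hy.le) (pulledBlockLaw_zero y)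
    (fun n hn => pulledAmp_renewal d y n hn) hK (pulledBlockLaw_one_pos (d + 1) hy) hM

/-- **The sandwich in partition-function form, every dimension, given the relation and a finite mean**:
`(2 - m(y))·e^{nλ_B(y)} ≤ Z^B_n(y) ≤ e^{nλ_B(y)}` for every `n`. [cite: MadrasSlade1993, Appendix B, (B.5); Beaton2015, §3] -/
theorem pulledBridgeZ_sandwich_of (d : ℕ) {y : ℝ} (hy : 0 < y)
    (hK : HasSum (pulledBlockLaw (d + 1) y) 1) (hM : Summable fun i : ℕ => (i : ℝ) * pulledBlockLaw (d + 1) y i)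
    (n : ℕ) :
    (2 - pulledMeanBlock (d + 1) y) * Real.exp ((n : ℝ) * pulledBridgeFreeEnergy (d + 1) y)
        ≤ pulledBridgeZ (d + 1) n y
    ∧ pulledBridgeZ (d + 1) n y ≤ Real.exp ((n : ℝ) * pulledBridgeFreeEnergy (d + 1) y) := by
  obtain ⟨h1, h2⟩ := two_sub_pulledMeanBlock_le_pulledAmp_of d hy hK hM n
  have hE : 0 < Real.exp ((n : ℝ) * pulledBridgeFreeEnergy (d + 1) y) := Real.exp_pos _
  have hkey : pulledAmp (d + 1) y n * Real.exp ((n : ℝ) * pulledBridgeFreeEnergy (d + 1) y)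
      = pulledBridgeZ (d + 1) n y := by
    unfold pulledAmp; rw [mul_assoc, ← Real.exp_add]; simp
  constructor
  · calc (2 - pulledMeanBlock (d + 1) y) * Real.exp ((n : ℝ) * pulledBridgeFreeEnergy (d + 1) y)
        ≤ pulledAmp (d + 1) y n * Real.exp ((n : ℝ) * pulledBridgeFreeEnergy (d + 1) y) :=
          mul_le_mul_of_nonneg_right h1 hE.le
      _ = _ := hkey
  · calc pulledBridgeZ (d + 1) n y
        = pulledAmp (d + 1) y n * Real.exp ((n : ℝ) * pulledBridgeFreeEnergy (d + 1) y) := hkey.symm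
      _ ≤ 1 * Real.exp ((n : ℝ) * pulledBridgeFreeEnergy (d + 1) y) := mul_le_mul_of_nonneg_right h2 hE.le
      _ = _ := one_mul _

/-- **Explicit exponential Ornstein–Zernike rate, every dimension, given the relation and a finite mean**: for any
`r ≥ 1` and values `G < 1`, `H` of the two tail series of the block law (`G = Σ_{j≥1} t_{j+1} r^j`,
`H = Σ_{j≥1} t_{j+1}(1 + ⋯ + r^{j-1})`, `t_j = 1 - Σ_{k<j} p_k`): `|a_n(y) - 1/m(y)| ≤ H/(m(y)(1-G)) · r^{-n}` for
EVERY `n` (`Renewal.abs_sub_inv_tsum_le`). [cite: MadrasSlade1993, Theorem 4.2.5] -/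
theorem abs_pulledAmp_sub_inv_le_of (d : ℕ) {y : ℝ} (hy : 0 < y)
    (hK : HasSum (pulledBlockLaw (d + 1) y) 1) (hM : Summable fun i : ℕ => (i : ℝ) * pulledBlockLaw (d + 1) y i)
    {r G H : ℝ} (hr : 1 ≤ r)
    (hG : HasSum (fun j : ℕ => (1 - ∑ k ∈ range (j + 2), pulledBlockLaw (d + 1) y k) * r ^ (j + 1)) G)
    (hG1 : G < 1)
    (hH : HasSum (fun j : ℕ => (1 - ∑ k ∈ range (j + 2), pulledBlockLaw (d + 1) y k) * ∑ l ∈ range (j + 1), r ^ l) H)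
    (n : ℕ) :
    |pulledAmp (d + 1) y n - (pulledMeanBlock (d + 1) y)⁻¹| ≤ H / (pulledMeanBlock (d + 1) y * (1 - G)) * r⁻¹ ^ n :=
  Literature.Probability.Process.Renewal.abs_sub_inv_tsum_le (pulledAmp_zero d y)
    (pulledBlockLaw_nonneg hy.le) (pulledBlockLaw_zero y) (fun n hn => pulledAmp_renewal d y n hn) hK hM hr hG hG1 hH n

/-- **The renewal gap from a ladder rung (R35.4♯ + R35.5♯ + R35.7♯)**: under the ladder gap condition, the pulled
Kesten relation, the finite mean, the all-`n` sandwich `2 - m(y) ≤ a_n(y) ≤ 1` and the OZ limit `a_n(y) → 1/m(y)`.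
[cite: MadrasSlade1993, Theorem 4.2.2 (b) and Appendix B, (B.5); Beaton2015, Lemma 2] -/
theorem pulledGap_ladder {y y' L U' : ℝ} (hy' : 1 ≤ y') (hyy : y' ≤ y) (hL : 0 < L) (hU : 0 < U')
    (hLB : Real.log L ≤ pulledBridgeFreeEnergy 2 y) (hUB : pulledBridgeFreeEnergy 2 y' ≤ Real.log U')
    (hq2 : y * U' ^ 3 < y' * L ^ 3) :
    HasSum (pulledBlockLaw 2 y) 1 ∧ (Summable fun i : ℕ => (i : ℝ) * pulledBlockLaw 2 y i)
    ∧ (∀ n : ℕ, 2 - pulledMeanBlock 2 y ≤ pulledAmp 2 y n ∧ pulledAmp 2 y n ≤ 1)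
    ∧ Tendsto (pulledAmp 2 y) atTop (𝓝 (pulledMeanBlock 2 y)⁻¹) := by
  have hy0 : 0 < y := by linarith
  have hK := hasSum_pulledBlockLaw_ladder hy' hyy hL hU hLB hUB hq2
  have hM := summable_mul_pulledBlockLaw_ladder hy' hyy hL hU hLB hUB hq2
  exact ⟨hK, hM, two_sub_pulledMeanBlock_le_pulledAmp_of 1 hy0 hK hM, tendsto_pulledAmp_of 1 hy0 hK hM⟩

/-- **The renewal gap at the rung `y' = 1` with any `U ≥ μ(ℤ²)`** (`log L ≤ λ_B(y)`, gap condition `y·U³ < L³`):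
relation ∧ finite mean ∧ all-`n` sandwich ∧ OZ limit. With `U = 2.688` this is the planner's `R35_main_of`
(`SAWPulledRenewalGapTilts.lean`); with `U = 3` it is standard-axiom.
[cite: Beaton2015, Lemma 2; MadrasSlade1993, Theorem 4.2.2 (b) and Appendix B, (B.5)] -/
theorem pulledGap_of_mu_le {y L U : ℝ} (hy : 1 ≤ y) (hL : 0 < L) (hU : connectiveConstant 2 ≤ U)
    (hLB : Real.log L ≤ pulledBridgeFreeEnergy 2 y) (hq : y * U ^ 3 < L ^ 3) :
    HasSum (pulledBlockLaw 2 y) 1 ∧ (Summable fun i : ℕ => (i : ℝ) * pulledBlockLaw 2 y i)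
    ∧ (∀ n : ℕ, 2 - pulledMeanBlock 2 y ≤ pulledAmp 2 y n ∧ pulledAmp 2 y n ≤ 1)
    ∧ Tendsto (pulledAmp 2 y) atTop (𝓝 (pulledMeanBlock 2 y)⁻¹) := by
  have hU0 : 0 < U := lt_of_lt_of_le (connectiveConstant_pos 2) hU
  exact pulledGap_ladder (y' := 1) le_rfl hy hL hU0 hLB (pulledBridgeFreeEnergy_one_le_log 1 hU) (by linarith)

/-! ### Data-free instances at the tree's certified tilts (span-1 Kraft windows, `U = 3`; standard axioms) -/

/-- Transfer of a span-1 tilted-Kraft lower bound to the free energy: `∃ κ > 0, ∀ N, κ ρ^N ≤ Z^B_N(y)` ⇒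
`log ρ ≤ λ_B(y)` (`ℤ²`). [cite: Beaton2015, Lemma 2; MadrasSlade1993, Lemma 1.2.2 (Fekete)] -/
theorem log_le_pulledBridgeFreeEnergy_of_exists {y ρ : ℝ} (hy : 0 < y) (hρ : 0 < ρ)
    (h : ∃ κ : ℝ, 0 < κ ∧ ∀ N : ℕ, κ * ρ ^ N ≤ pulledBridgeZ 2 N y) :
    Real.log ρ ≤ pulledBridgeFreeEnergy 2 y := by
  obtain ⟨κ, hκ, h⟩ := h
  exact log_le_pulledBridgeFreeEnergy_of_geometric 1 hy hκ hρ h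

/-- `μ(ℤ²) ≤ 3`, in the form consumed here. [cite: BDGS2012, §1.3, eq. (1.13)] -/
theorem connectiveConstant_two_le_three : connectiveConstant 2 ≤ 3 := by
  have h := connectiveConstant_le 2 (by norm_num)
  norm_num at h
  exact h

/-- **`y = 4`** (`U = 3`, `L = 10⁴/1754`: `4·27 = 108 < L³ = 185.3`): relation ∧ finite mean ∧ all-`n` sandwich ∧ OZ limit,
standard axioms. [cite: Beaton2015, Lemma 2; MadrasSlade1993, Theorem 4.2.2 (b)] -/
theorem pulledGap_four :
    HasSum (pulledBlockLaw 2 (4 : ℝ)) 1 ∧ (Summable fun i : ℕ => (i : ℝ) * pulledBlockLaw 2 (4 : ℝ) i)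
    ∧ (∀ n : ℕ, 2 - pulledMeanBlock 2 4 ≤ pulledAmp 2 4 n ∧ pulledAmp 2 4 n ≤ 1)
    ∧ Tendsto (pulledAmp 2 (4 : ℝ)) atTop (𝓝 (pulledMeanBlock 2 4)⁻¹) :=
  pulledGap_of_mu_le (L := 10000 / 1754) (by norm_num) (by norm_num) connectiveConstant_two_le_three
    (log_le_pulledBridgeFreeEnergy_of_exists (by norm_num) (by norm_num) pulledBridgeZ_four_lower) (by norm_num)

/-- **`y = 3`** (`U = 3`, `L = 10⁴/2153`: `81 < 100.2`). [cite: Beaton2015, Lemma 2; MadrasSlade1993, Theorem 4.2.2 (b)] -/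
theorem pulledGap_three :
    HasSum (pulledBlockLaw 2 (3 : ℝ)) 1 ∧ (Summable fun i : ℕ => (i : ℝ) * pulledBlockLaw 2 (3 : ℝ) i)
    ∧ (∀ n : ℕ, 2 - pulledMeanBlock 2 3 ≤ pulledAmp 2 3 n ∧ pulledAmp 2 3 n ≤ 1)
    ∧ Tendsto (pulledAmp 2 (3 : ℝ)) atTop (𝓝 (pulledMeanBlock 2 3)⁻¹) :=
  pulledGap_of_mu_le (L := 10000 / 2153) (by norm_num) (by norm_num) connectiveConstant_two_le_three
    (log_le_pulledBridgeFreeEnergy_of_exists (by norm_num) (by norm_num) pulledBridgeZ_three_lower) (by norm_num)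

/-- **`y = 256/81`** (`U = 3`, `L = 10⁴/2077`: `85.3 < 111.6`). [cite: Beaton2015, Lemma 2; MadrasSlade1993, Theorem 4.2.2 (b)] -/
theorem pulledGap_r256_81 :
    HasSum (pulledBlockLaw 2 ((256 : ℝ) / 81)) 1
    ∧ (Summable fun i : ℕ => (i : ℝ) * pulledBlockLaw 2 ((256 : ℝ) / 81) i)
    ∧ (∀ n : ℕ, 2 - pulledMeanBlock 2 ((256 : ℝ) / 81) ≤ pulledAmp 2 ((256 : ℝ) / 81) n
        ∧ pulledAmp 2 ((256 : ℝ) / 81) n ≤ 1)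
    ∧ Tendsto (pulledAmp 2 ((256 : ℝ) / 81)) atTop (𝓝 (pulledMeanBlock 2 ((256 : ℝ) / 81))⁻¹) :=
  pulledGap_of_mu_le (L := 10000 / 2077) (by norm_num) (by norm_num) connectiveConstant_two_le_three
    (log_le_pulledBridgeFreeEnergy_of_exists (by norm_num) (by norm_num) pulledBridgeZ_r256_81_lower) (by norm_num)

end Literature.Probability.RandomPlanarGeometry.SAW.Zd
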